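import Literature.AlgebraicGeometry.HodgeTheory.HOneOfProductEndomorphismBlocks
import Literature.AlgebraicGeometry.HodgeTheory.RealSl2Blocks
import HarnessLib

/-!
# `Lie Hg(A₁ × A₂) = 𝔰𝔭_{E₁ × E₂}(H¹(A₁ × A₂), ψ) = Lie Hg(A₁) ⊕ Lie Hg(A₂)` for orthogonal real-multiplication varieties of relative dimension one (Hazama; Moonen–Zarhin Thm. (3.2)(1))

Family `hodge`, layer `Literature/AlgebraicGeometry/HodgeTheory`. Research context: cell `pub-hodge-ring2`
(HONEST FRAMING: research route conditional on HC_CM; not a corollary; Q11.4-sentence-2 already refuted in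
dim ≥ 3), Literature lane, programme R3 (`pub-hodge-ring2-lit-g40/PLAN-R3.md`, assembly B′6). UNCONDITIONAL
Hodge theory of abelian varieties (`hHD`, `hI` are tree theorems; Riemann's theorem
`deligneMilne1982_Thm_6_20_full_holds` is a tree theorem); no named fact; no step towards a summit statement.

PUBLISHED STATEMENT. Moonen–Zarhin, *Hodge classes on abelian varieties of low dimension*, Duke Math. J. 98
(1999), Thm. (3.2)(1) (after Hazama, Duke Math. J. 58 (1989)): «Let `X₁` and `X₂` be complex abelian
varieties which both satisfy condition (D). (1) Suppose `X₁` and `X₂` contain no factors of Type 4. Then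
`X₁ × X₂` again satisfies (D), and either `Hom(X₁, X₂) ≠ 0` or `Hg(X₁ × X₂) = Hg(X₁) × Hg(X₂)`.»
Hazama 1983 §3 / Ribet 1983 Thm. 0–1: for `End⁰(X)` a totally real field `E` of degree `dim X`,
`Lie Hg(X) = 𝔰𝔭_E(H¹, ψ)`, `Lie Hg(X)_ℂ = ⊕_τ 𝔰𝔩(V_τ)`.

TREE STATEMENT (the Lie-algebra form of the second alternative, for the class where the tree's Hodge group is
computed — `End⁰(A_i) = E_i` totally real fields with `[E_i : ℚ] = dim A_i`, `Hom(A₁, A₂) = 0 = Hom(A₂, A₁)`):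
* (`RealSl2Blocks`: `endAlgebra_prod_comm_of_orthogonal` — `End⁰(A₁ × A₂) (= E₁ × E₂)` is commutative; `embCharacter`,
  the characters of `End⁰(A_i)` attached to the embeddings of `E_i`, and their blocks;)
* **`mem_hodgeLie_hodge_one_prod_iff_of_isTotallyReal`** — for EVERY polarization `ψ` of `H¹((A₁ × A₂)(ℂ); ℚ)`:
  `X ∈ Lie Hg(A₁ × A₂)` iff `X` commutes with `End⁰(A₁ × A₂)` acting by `z ↦ z^*` and is `ψ`-skew — i.e.
  **`Lie Hg(A₁ × A₂) = 𝔰𝔭_{E₁ × E₂}(H¹(A₁ × A₂), ψ)`**;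
* **`mem_hodgeLieC_hodge_one_prod_iff_mapsTo_of_isTotallyReal`** — `Y ∈ Lie Hg(A₁ × A₂) ⊗ ℂ` iff `Y` preserves
  every `pr₁^* V_τ(A₁)` (`τ : E₁ → ℂ`) and every `pr₂^* V_{τ'}(A₂)` (`τ' : E₂ → ℂ`) and is `ψ_ℂ`-skew — i.e.
  **`Lie Hg(A₁ × A₂)_ℂ = ⊕_τ 𝔰𝔩(pr₁^* V_τ(A₁)) ⊕ ⊕_{τ'} 𝔰𝔩(pr₂^* V_{τ'}(A₂)) = Lie Hg(A₁)_ℂ ⊕ Lie Hg(A₂)_ℂ`**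
  («`Hg(X₁ × X₂) = Hg(X₁) × Hg(X₂)`» at the level of complex Lie algebras, the factors' Lie algebras being
  `⊕_τ 𝔰𝔩(V_τ)` by the tree's `mem_hodgeLieC_hodge_one_iff_mapsTo_of_isTotallyReal`);
* `…_of_isSimple_of_not_isIsogenous` — the same for `A₁`, `A₂` simple and non-isogenous.
PROOF: the tree's field-free theorem `HodgeStructure.mem_hodgeLie_iff_commute_and_skew_of_real_characters`
(R2a with `hself` automatic, `Motives/HodgeEndomorphismsSelfAdjointOfRealCharacters`) applied to the bridge
`HOneOfProductEndomorphismBlocks` (characters `prodCharacter`, blocks `pr_i^* V_τ(A_i)`, internal direct sum,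
dimension two) and `End⁰(A₁ × A₂) = E₁ × E₂` (`NoTypeIVFactorOrthogonalProducts`). No Goursat lemma is needed:
the commutant of `E₁ × E₂` already splits along `H¹ = pr₁^* H¹(A₁) ⊕ pr₂^* H¹(A₂)`.

## References

* [MoonenZarhin1999LowDim] B. Moonen, Yu. Zarhin, *Hodge classes on abelian varieties of low dimension*,
  Duke Math. J. 98 (1999), §3 Thm. (3.2)(1) [corpus: paper:arxiv-math_9901113 p. 6].
  [cite: MoonenZarhin1999LowDim, §3 Thm. (3.2)(1)]
* [Hazama1989] F. Hazama, *Algebraic cycles on nonsimple abelian varieties*, Duke Math. J. 58 (1989), Thm.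
  [cite: Hazama1989, Thm. (= Gordon 7.6.2)]
* [Hazama1983] F. Hazama, Tôhoku Math. J. 35 (1983), Thm. (1.1) and §3. [cite: Hazama1983, Thm. (1.1) and §3 (pp. 305–306)]
* [Ribet1983] K. A. Ribet, Amer. J. Math. 105 (1983), Thm. 0–1. [cite: Ribet1983, Thm. 0–1]
-/

noncomputable section

open scoped TensorProduct
open CategoryTheory Module NumberField

namespace Literature.AlgebraicGeometry.HodgeTheory

open Literature.AlgebraicGeometry.Motives Literature.AlgebraicGeometry.ComplexMultiplication
open Literature.AlgebraicGeometry.Motives.HodgeStructure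
open Literature.AlgebraicGeometry.Milne1999.CMTypeProducts

section RealMultiplicationProduct

variable {A B : AbelianVariety ℂ}

/-! ### `Lie Hg(A × B) = 𝔰𝔭_{E₁ × E₂}(H¹(A × B), ψ)` -/

variable (hF₁ : IsField A.endAlgebra) (hF₂ : IsField B.endAlgebra)

/-- **Theorem (Hazama 1989; Moonen–Zarhin 1999 Thm. (3.2)(1), Lie-algebra form: `Hg(A × B) = Hg(A) × Hg(B) =
R_{E₁/ℚ} SL_{2,E₁} × R_{E₂/ℚ} SL_{2,E₂}` for orthogonal real-multiplication varieties of relative dimension one).**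
Let `A`, `B` be complex abelian varieties with `End⁰(A) = E₁`, `End⁰(B) = E₂` totally real fields of degrees
`dim A`, `dim B`, and `Hom(A, B) = 0 = Hom(B, A)`. For EVERY polarization `ψ` of `H¹((A × B)(ℂ); ℚ)`, a `ℚ`-linear
endomorphism `X` of `H¹((A × B)(ℂ); ℚ)` lies in `Lie Hg(A × B)` iff it commutes with every `z^*`,
`z ∈ End⁰(A × B) (= E₁ × E₂)`, and is `ψ`-skew: `Lie Hg(A × B) = 𝔰𝔭_{E₁ × E₂}(H¹(A × B), ψ)`.
[cite: MoonenZarhin1999LowDim, §3 Thm. (3.2)(1)] [cite: Hazama1989, Thm. (= Gordon 7.6.2)]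
[cite: Hazama1983, Thm. (1.1) and §3 (pp. 305–306)] [cite: Ribet1983, Thm. 0–1] -/
theorem mem_hodgeLie_hodge_one_prod_iff_of_isTotallyReal [HodgeTensorFacts.{0, 0}]
    [Module.Finite ℚ (bettiCohomology (A.prod B).X 1)]
    (hHD : exists_isReal_hodgeModel) (hI : hodgePQ_independent_of_hodgeModel)
    [IsTotallyReal (EndField A hF₁)] [IsTotallyReal (EndField B hF₂)]
    (hdeg₁ : Module.finrank ℚ A.endAlgebra = A.dim) (hdeg₂ : Module.finrank ℚ B.endAlgebra = B.dim)
    (hAB : ∀ f : A ⟶ B, f = 0) (hBA : ∀ g : B ⟶ A, g = 0)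
    (ψ : (BettiUniverse.hodge hHD (AbelianVariety.isSmoothProjective_holds (A := A.prod B)) 1).Polarization)
    (X : Module.End ℚ (bettiCohomology (A.prod B).X 1)) :
    X ∈ (BettiUniverse.hodge hHD (AbelianVariety.isSmoothProjective_holds (A := A.prod B)) 1).hodgeLie ↔
      (∀ z : (A.prod B).endAlgebra,
        X * MulOpposite.unop (bettiRep (A.prod B) z) = MulOpposite.unop (bettiRep (A.prod B) z) * X) ∧
      (∀ v w, ψ.form (X v) w + ψ.form v (X w) = 0) := by
  classical
  have hc := endAlgebra_prod_comm_of_orthogonal hF₁.mul_comm hF₂.mul_comm hAB hBA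
  have hn : (((1 : ℕ) : ℤ)) = 1 := by norm_num
  have heff := BettiUniverse.hodge_isEffective hHD (AbelianVariety.isSmoothProjective_holds (A := A.prod B)) 1
  rw [mem_hodgeLie_iff_commute_and_skew_of_real_characters
    (BettiUniverse.hodge hHD (AbelianVariety.isSmoothProjective_holds (A := A.prod B)) 1) hn heff ψ
    (HOneProduct.prodCharacter A B hHD hI hc (embCharacter hF₁) (embCharacter hF₂))
    (HOneProduct.prodCharacter_isReal hHD hI hc (embCharacter_isReal hF₁) (embCharacter_isReal hF₂))
    (HOneProduct.isInternal_eigenBlock_prodCharacter hHD hI hc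
      (isInternal_iInf_eigenspace_embCharacter hF₁ hHD hI) (isInternal_iInf_eigenspace_embCharacter hF₂ hHD hI))
    (HOneProduct.finrank_eigenBlock_prodCharacter hHD hI hc
      (finrank_iInf_eigenspace_embCharacter hF₁ hHD hI hdeg₁)
      (finrank_iInf_eigenspace_embCharacter hF₂ hHD hI hdeg₂)) X]
  refine and_congr ⟨fun h z => ?_, fun h a => ?_⟩ Iff.rfl
  · have h1 := h (endAlgebraAlgEquivEndAlgOfComm hc hHD hI z)
    rwa [coe_endAlgebraAlgEquivEndAlgOfComm_apply] at h1
  · obtain ⟨z, rfl⟩ := (endAlgebraAlgEquivEndAlgOfComm hc hHD hI).surjective a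
    rw [coe_endAlgebraAlgEquivEndAlgOfComm_apply]
    exact h z

/-- **Complexified block form: `Lie Hg(A × B)_ℂ = ⊕_τ 𝔰𝔩(pr₁^* V_τ(A)) ⊕ ⊕_{τ'} 𝔰𝔩(pr₂^* V_{τ'}(B))
= Lie Hg(A)_ℂ ⊕ Lie Hg(B)_ℂ`** («`Hg(X₁ × X₂) = Hg(X₁) × Hg(X₂)`», Moonen–Zarhin Thm. (3.2)(1) second
alternative, at the level of complex Lie algebras): a `ℂ`-linear endomorphism of `H¹((A × B)(ℂ); ℚ) ⊗ ℂ` lies in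
`Lie Hg(A × B) ⊗ ℂ` iff it preserves every block `pr₁^* V_τ(A)`, `τ : E₁ → ℂ`, every block `pr₂^* V_{τ'}(B)`,
`τ' : E₂ → ℂ`, and is `ψ_ℂ`-skew. [cite: MoonenZarhin1999LowDim, §3 Thm. (3.2)(1)]
[cite: Hazama1989, Thm. (= Gordon 7.6.2)] [cite: Hazama1983, §3 (pp. 305–306)] -/
theorem mem_hodgeLieC_hodge_one_prod_iff_mapsTo_of_isTotallyReal [HodgeTensorFacts.{0, 0}]
    [Module.Finite ℚ (bettiCohomology (A.prod B).X 1)]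
    (hHD : exists_isReal_hodgeModel) (hI : hodgePQ_independent_of_hodgeModel)
    [IsTotallyReal (EndField A hF₁)] [IsTotallyReal (EndField B hF₂)]
    (hdeg₁ : Module.finrank ℚ A.endAlgebra = A.dim) (hdeg₂ : Module.finrank ℚ B.endAlgebra = B.dim)
    (hAB : ∀ f : A ⟶ B, f = 0) (hBA : ∀ g : B ⟶ A, g = 0)
    (ψ : (BettiUniverse.hodge hHD (AbelianVariety.isSmoothProjective_holds (A := A.prod B)) 1).Polarization)
    (Y : Module.End ℂ (ℂ ⊗[ℚ] bettiCohomology (A.prod B).X 1)) :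
    Y ∈ (BettiUniverse.hodge hHD (AbelianVariety.isSmoothProjective_holds (A := A.prod B)) 1).hodgeLieC ↔
      ((∀ τ : EndField A hF₁ →+* ℂ, Set.MapsTo Y
          (((BettiUniverse.hodge hHD (AbelianVariety.isSmoothProjective_holds (A := A)) 1).eigenBlock
              (hodgeCharacter hF₁ hHD hI τ)).map ((HOneProduct.pullFst A B).baseChange ℂ))
          (((BettiUniverse.hodge hHD (AbelianVariety.isSmoothProjective_holds (A := A)) 1).eigenBlock
              (hodgeCharacter hF₁ hHD hI τ)).map ((HOneProduct.pullFst A B).baseChange ℂ))) ∧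
        (∀ τ : EndField B hF₂ →+* ℂ, Set.MapsTo Y
          (((BettiUniverse.hodge hHD (AbelianVariety.isSmoothProjective_holds (A := B)) 1).eigenBlock
              (hodgeCharacter hF₂ hHD hI τ)).map ((HOneProduct.pullSnd A B).baseChange ℂ))
          (((BettiUniverse.hodge hHD (AbelianVariety.isSmoothProjective_holds (A := B)) 1).eigenBlock
              (hodgeCharacter hF₂ hHD hI τ)).map ((HOneProduct.pullSnd A B).baseChange ℂ)))) ∧
      (∀ x y, ψ.form.baseChange ℂ (Y x) y + ψ.form.baseChange ℂ x (Y y) = 0) := by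
  classical
  have hc := endAlgebra_prod_comm_of_orthogonal hF₁.mul_comm hF₂.mul_comm hAB hBA
  have hn : (((1 : ℕ) : ℤ)) = 1 := by norm_num
  have heff := BettiUniverse.hodge_isEffective hHD (AbelianVariety.isSmoothProjective_holds (A := A.prod B)) 1
  rw [mem_hodgeLieC_iff_mapsTo_and_skew_of_real_characters
    (BettiUniverse.hodge hHD (AbelianVariety.isSmoothProjective_holds (A := A.prod B)) 1) hn heff ψ
    (HOneProduct.prodCharacter A B hHD hI hc (embCharacter hF₁) (embCharacter hF₂))
    (HOneProduct.prodCharacter_isReal hHD hI hc (embCharacter_isReal hF₁) (embCharacter_isReal hF₂))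
    (HOneProduct.isInternal_eigenBlock_prodCharacter hHD hI hc
      (isInternal_iInf_eigenspace_embCharacter hF₁ hHD hI) (isInternal_iInf_eigenspace_embCharacter hF₂ hHD hI))
    (HOneProduct.finrank_eigenBlock_prodCharacter hHD hI hc
      (finrank_iInf_eigenspace_embCharacter hF₁ hHD hI hdeg₁)
      (finrank_iInf_eigenspace_embCharacter hF₂ hHD hI hdeg₂)) Y, Sum.forall]
  simp only [HOneProduct.prodCharacter_inl, HOneProduct.prodCharacter_inr, HOneProduct.eigenBlock_prodFstCharacter,
    HOneProduct.eigenBlock_prodSndCharacter, iInf_eigenspace_embCharacter_eq hF₁ hHD hI,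
    iInf_eigenspace_embCharacter_eq hF₂ hHD hI]

/-! ### Simple, non-isogenous factors -/

/-- **The same for `A`, `B` SIMPLE and NON-ISOGENOUS** (then `Hom(A, B) = 0 = Hom(B, A)`,
`orthogonal_of_isSimple_of_not_isIsogenous₂`): `Lie Hg(A × B) = 𝔰𝔭_{E₁ × E₂}(H¹(A × B), ψ)` for every
polarization `ψ`. [cite: MoonenZarhin1999LowDim, §3 Thm. (3.2)(1)] [cite: Hazama1989, Thm. (= Gordon 7.6.2)] -/
theorem mem_hodgeLie_hodge_one_prod_iff_of_isTotallyReal_of_isSimple [HodgeTensorFacts.{0, 0}]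
    [Module.Finite ℚ (bettiCohomology (A.prod B).X 1)]
    (hHD : exists_isReal_hodgeModel) (hI : hodgePQ_independent_of_hodgeModel)
    [IsTotallyReal (EndField A hF₁)] [IsTotallyReal (EndField B hF₂)]
    (hdeg₁ : Module.finrank ℚ A.endAlgebra = A.dim) (hdeg₂ : Module.finrank ℚ B.endAlgebra = B.dim)
    (hA : A.IsSimple) (hB : B.IsSimple) (hAB : ¬ AbelianVariety.IsIsogenous A B)
    (ψ : (BettiUniverse.hodge hHD (AbelianVariety.isSmoothProjective_holds (A := A.prod B)) 1).Polarization)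
    (X : Module.End ℚ (bettiCohomology (A.prod B).X 1)) :
    X ∈ (BettiUniverse.hodge hHD (AbelianVariety.isSmoothProjective_holds (A := A.prod B)) 1).hodgeLie ↔
      (∀ z : (A.prod B).endAlgebra,
        X * MulOpposite.unop (bettiRep (A.prod B) z) = MulOpposite.unop (bettiRep (A.prod B) z) * X) ∧
      (∀ v w, ψ.form (X v) w + ψ.form v (X w) = 0) :=
  mem_hodgeLie_hodge_one_prod_iff_of_isTotallyReal hF₁ hF₂ hHD hI hdeg₁ hdeg₂
    (orthogonal_of_isSimple_of_not_isIsogenous₂ hA hB hAB).1 (orthogonal_of_isSimple_of_not_isIsogenous₂ hA hB hAB).2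
    ψ X

end RealMultiplicationProduct

end Literature.AlgebraicGeometry.HodgeTheory

end
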